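import Literature.Analysis.Fourier.FejerJacksonKernels
import Mathlib.Analysis.SpecialFunctions.Integrals.Basic
import Mathlib.Algebra.Order.Round
import Mathlib.Tactic
import HarnessLib

/-!
# One-sided trigonometric approximation and the Erdős–Turán inequality

Travaglini, *Number Theory, Fourier Analysis and Geometric Discrepancy* (LMS Student Texts 81),
§7.1 Theorem 7.2 (one-sided approximation: for every interval `I ⊂ 𝕋` and `N` there are
trigonometric polynomials `p⁻ ≤ χ_I ≤ p⁺` of degree `≤ N` with `∫(p⁺ − p⁻) ≤ c/N`, built from
the Jackson kernel `J_N` and the weighted indicator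
`f_{s,N} = (1 + G/(N³(s − |x| + 2/N)³)) χ_{I_{s+1/N}}`, eq. (7.2)) and §7.2 Theorem 7.3
(Erdős–Turán: `D_N ≤ c (N/H + Σ_{k=1}^{H} (1/k)|Σ_j e^{2πikω(j)}|)`, via
`|p̂⁺(k)| ≤ ‖p⁺ − χ_I‖₁ + 1/(π|k|)`, eq. (7.7)). The Erdős–Turán inequality is the form in which
Calegari–Dimitrov–Tang (arXiv:2408.15403, §4.2) control the box discrepancy.

This file follows that construction with the peak window `δ = 1/(2(M+1))` in place of `1/N`
and all constants explicit: weight `w(t) = A/((M+1)³(r + δ − |t|)³)` on `[−r, r]`,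
`r = s + δ`, `A = 100`; the majorant `p⁺(x) = ∫ f(y) J_M(x − y) dy` satisfies `p⁺ ≥ 0`,
`p⁺ ≥ 1` on the arc `‖x‖ ≤ s` (peak mass `∫_{−δ}^{δ} J ≥ 16/π⁴` against the tail
`∫_{a}^{1/2} J ≤ π⁴/(384(M+1)³a³)`, and `27π⁸ < 307200`), `∫ f ≤ 2s + 2δ + 4A/(M+1)`,
`|f̂(d)| ≤ 1/(π|d|) + 4A/(M+1)`; writing `J_M` as a quadruple exponential sum and counting
frequencies by orthogonality (`coefC · #{q : d_q = d} = Ĵ(d) ≤ 1`) gives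
`Σ_n p⁺(ω_n − m) ≤ (2s + 2δ + 4A/(M+1)) N + Σ_{0<|d|≤2M} (1/(π|d|) + 4A/(M+1)) |S(d)|`, and with
the complementary arc the two-sided bound.

* `majorP` (`p⁺`), `one_le_majorP`, `majorP_nonneg`, `majorP_eq_sum`, `sum_majorP_le`.
* `integral_majorP`, `integral_majorP_le` — `∫₀¹ p⁺ = Re f̂(0) ≤ 2s + 401/(M+1)` (the quantitative
  majorant half of Travaglini's Thm 7.2, eq. (7.1)).
* `erdosTuran_arc` — `|#{n : ‖ω_n − m‖ ≤ s} − 2sN| ≤ 802 N/H + (2/π + 1600) Σ_{d=1}^{H} |S(d)|/d`.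
* `erdosTuran` — **the Erdős–Turán inequality** for intervals `[a, b) ⊂ [0, 1)`:
  `|#{n : a ≤ {ω_n} < b} − (b − a)N| ≤ 802 N/H + (2/π + 1600) Σ_{d=1}^{H} |Σ_n e(dω_n)|/d`;
  `erdosTuran_closed` — the same for closed intervals `[a, b] ⊆ [0, 1]` (CDT Definition 44).

No named facts.

## References

* [Travaglini2014] G. Travaglini, Number Theory, Fourier Analysis and Geometric Discrepancy,
  LMS Student Texts 81 (CUP 2014), §7.1 Thm 7.2, §7.2 Thm 7.3, eq. (7.2)–(7.7).
* [CalegariDimitrovTang2024] arXiv:2408.15403, §4.2 (the Erdős–Turán inequality, used for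
  Theorem 45).
-/

noncomputable section

open Real Finset MeasureTheory intervalIntegral Complex

namespace Literature.Analysis.Fourier.TrigApprox

/-! ## One-sided approximation: the majorant `p⁺ = f * J` (Travaglini Thm 7.2) -/

section Majorant

variable (M : ℕ)

/-- `δ = 1/(2(M+1))`, the peak half-width. [folklore] -/
def del (M : ℕ) : ℝ := 1 / (2 * (M + 1))

/-- `δ > 0`. [folklore] -/
theorem del_pos : 0 < del M := by unfold del; positivity

/-- The weight `w(t) = A/((M+1)³ (r + δ − |t|)³)`. [cite: Travaglini2014, §7.1 eq. (7.2)] -/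
def weightW (M : ℕ) (A r t : ℝ) : ℝ := A / ((M + 1) ^ 3 * (r + del M - |t|) ^ 3)

/-- The weighted indicator `f = (1 + w) χ_{[−r, r]}`, `r = s + δ`. [cite: Travaglini2014, §7.1 eq. (7.2)] -/
def majorF (M : ℕ) (A s t : ℝ) : ℝ :=
  if |t| ≤ s + del M then 1 + weightW M A (s + del M) t else 0

/-- The majorant `p⁺(x) = ∫ f(y) J(x − y) dy`. [cite: Travaglini2014, §7.1] -/
def majorP (M : ℕ) (A s x : ℝ) : ℝ :=
  ∫ y in (-(s + del M))..(s + del M), majorF M A s y * jackson M (x - y)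

variable {M}

/-- `w ≥ 0` on `[−r, r]`. [folklore] -/
theorem weightW_nonneg {A r t : ℝ} (hA : 0 ≤ A) (ht : |t| ≤ r) : 0 ≤ weightW M A r t := by
  unfold weightW
  have := del_pos M
  apply div_nonneg hA
  have : 0 ≤ r + del M - |t| := by linarith
  positivity

/-- `f ≥ 0`. [folklore] -/
theorem majorF_nonneg {A s t : ℝ} (hA : 0 ≤ A) : 0 ≤ majorF M A s t := by
  unfold majorF
  split_ifs with h
  · have := weightW_nonneg (M := M) (r := s + del M) hA h; linarith
  · exact le_rfl

/-- `∫_{x−1/2}^{x+1/2} J(x − y) dy = 1` (periodicity). [folklore] -/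
theorem integral_jackson_window (x : ℝ) :
    ∫ y in (x - 1 / 2)..(x + 1 / 2), jackson M (x - y) = 1 := by
  rw [intervalIntegral.integral_comp_sub_left (fun u => jackson M u) x]
  simp only [show x - (x + 1 / 2) = -(1 / 2 : ℝ) by ring,
    show x - (x - 1 / 2) = (1 / 2 : ℝ) by ring]
  -- `∫_{−1/2}^{1/2} J = ∫_{−1/2}^{0} J + ∫_0^{1/2} J = ∫_{1/2}^{1} J + ∫_0^{1/2} J = ∫_0^1 J = 1`
  have hc := continuous_jackson M
  have h1 : ∫ u in (-(1 / 2 : ℝ))..0, jackson M u = ∫ u in (1 / 2 : ℝ)..1, jackson M u := by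
    have := intervalIntegral.integral_comp_add_right (fun u => jackson M u) (1 : ℝ) (a := -(1/2)) (b := 0)
    rw [show (-(1 / 2 : ℝ)) + 1 = 1 / 2 by norm_num, zero_add] at this
    rw [← this]
    refine intervalIntegral.integral_congr fun u _ => ?_
    simpa using (jackson_add_int M u 1).symm
  rw [← intervalIntegral.integral_add_adjacent_intervals (b := 0) (hc.intervalIntegrable _ _)
    (hc.intervalIntegrable _ _), h1, add_comm,
    intervalIntegral.integral_add_adjacent_intervals (hc.intervalIntegrable _ _) (hc.intervalIntegrable _ _)]
  exact integral_jackson M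

/-- `∫_a^b du/u⁴ = 1/(3a³) − 1/(3b³)` for `0 < a ≤ b`. [folklore] -/
theorem integral_inv_pow_four {a b : ℝ} (ha : 0 < a) (hab : a ≤ b) :
    ∫ u in a..b, 1 / u ^ 4 = 1 / (3 * a ^ 3) - 1 / (3 * b ^ 3) := by
  have hderiv : ∀ u ∈ Set.uIcc a b, HasDerivAt (fun u : ℝ => -1 / (3 * u ^ 3)) (1 / u ^ 4) u := by
    intro u hu
    rw [Set.uIcc_of_le hab] at hu
    have hu0 : u ≠ 0 := (ha.trans_le hu.1).ne'
    have h1 : HasDerivAt (fun u : ℝ => u ^ 3) (3 * u ^ 2) u := by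
      simpa using hasDerivAt_pow 3 u
    have h2 : HasDerivAt (fun u : ℝ => (u ^ 3)⁻¹) (-(3 * u ^ 2) / (u ^ 3) ^ 2) u :=
      h1.inv (pow_ne_zero 3 hu0)
    have h3 := h2.const_mul (-1 / 3 : ℝ)
    have hfun : (fun u : ℝ => -1 / (3 * u ^ 3)) = fun y => -1 / 3 * (y ^ 3)⁻¹ := by
      funext y; ring
    have hval : -1 / 3 * (-(3 * u ^ 2) / (u ^ 3) ^ 2) = 1 / u ^ 4 := by
      field_simp
    rw [hfun, ← hval]; exact h3
  have hcont : ContinuousOn (fun u : ℝ => 1 / u ^ 4) (Set.uIcc a b) := by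
    rw [Set.uIcc_of_le hab]
    refine ContinuousOn.div continuousOn_const (continuousOn_pow 4) fun u hu => ?_
    exact pow_ne_zero 4 (ha.trans_le hu.1).ne'
  rw [intervalIntegral.integral_eq_sub_of_hasDerivAt hderiv (hcont.intervalIntegrable)]
  have hb0 : b ≠ 0 := (ha.trans_le hab).ne'
  field_simp
  ring

/-- The tail `∫_{a}^{1/2} J ≤ π⁴/(384 (M+1)³ a³)` for `0 < a ≤ 1/2`. [folklore] -/
theorem integral_jackson_tail_le {a : ℝ} (ha0 : 0 < a) (ha : a ≤ 1 / 2) :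
    ∫ u in a..(1 / 2), jackson M u ≤ π ^ 4 / (384 * (M + 1) ^ 3 * a ^ 3) := by
  have hM : (0 : ℝ) < M + 1 := by positivity
  have h1 : ∫ u in a..(1 / 2), jackson M u ≤
      ∫ u in a..(1 / 2), π ^ 4 / (128 * (M + 1) ^ 3) * (1 / u ^ 4) := by
    refine intervalIntegral.integral_mono_on ha ((continuous_jackson M).intervalIntegrable _ _) ?_
      fun u hu => ?_
    · refine ContinuousOn.intervalIntegrable ?_
      rw [Set.uIcc_of_le ha]
      refine ContinuousOn.mul continuousOn_const ?_
      refine ContinuousOn.div continuousOn_const (continuousOn_pow 4) fun u hu => ?_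
      exact pow_ne_zero 4 (ha0.trans_le hu.1).ne'
    · have hu0 : u ≠ 0 := (ha0.trans_le hu.1).ne'
      have hua : |u| ≤ 1 / 2 := by rw [abs_of_pos (ha0.trans_le hu.1)]; exact hu.2
      have := jackson_le_inv M hu0 hua
      have hu4 : 0 < u ^ 4 := by positivity
      rw [show π ^ 4 / (128 * (M + 1) ^ 3) * (1 / u ^ 4) = π ^ 4 / (128 * (M + 1) ^ 3 * u ^ 4) by
        field_simp]
      exact this
  refine h1.trans ?_
  rw [intervalIntegral.integral_const_mul, integral_inv_pow_four ha0 ha]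
  have ha3 : 0 < a ^ 3 := by positivity
  have hK3 : 0 < ((M : ℝ) + 1) ^ 3 := by positivity
  have hid : π ^ 4 / (128 * ((M : ℝ) + 1) ^ 3) * (1 / (3 * a ^ 3) - 1 / (3 * (1 / 2) ^ 3)) =
      π ^ 4 / (384 * (M + 1) ^ 3 * a ^ 3) - 8 * π ^ 4 / (384 * (M + 1) ^ 3) := by
    field_simp
    ring
  rw [hid]
  have : 0 ≤ 8 * π ^ 4 / (384 * ((M : ℝ) + 1) ^ 3) := by positivity
  linarith

variable {M : ℕ}

/-- On `[−r, r]`, `f = 1 + w`; so `p⁺(x) = ∫_{−r}^{r} J(x−y) dy + ∫_{−r}^{r} w(y) J(x−y) dy`. [folklore] -/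
theorem majorP_eq {A s : ℝ} (hs : 0 ≤ s) (x : ℝ) :
    majorP M A s x = (∫ y in (-(s + del M))..(s + del M), jackson M (x - y)) +
      ∫ y in (-(s + del M))..(s + del M), weightW M A (s + del M) y * jackson M (x - y) := by
  have hδ := del_pos M
  have hr0 : 0 ≤ s + del M := by positivity
  have hi1 : IntervalIntegrable (fun y => jackson M (x - y)) volume (-(s + del M)) (s + del M) :=
    ((continuous_jackson M).comp (continuous_const.sub continuous_id)).intervalIntegrable _ _
  have hi2 : IntervalIntegrable (fun y => weightW M A (s + del M) y * jackson M (x - y)) volume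
      (-(s + del M)) (s + del M) := by
    refine ContinuousOn.intervalIntegrable ?_
    rw [Set.uIcc_of_le (by linarith)]
    refine ContinuousOn.mul ?_
      ((continuous_jackson M).comp (continuous_const.sub continuous_id)).continuousOn
    unfold weightW
    refine ContinuousOn.div continuousOn_const (by fun_prop) fun y hy => ?_
    have : |y| ≤ s + del M := abs_le.mpr ⟨hy.1, hy.2⟩
    have : 0 < s + del M + del M - |y| := by linarith
    positivity
  unfold majorP
  rw [← intervalIntegral.integral_add hi1 hi2]
  refine intervalIntegral.integral_congr fun y hy => ?_
  rw [Set.uIcc_of_le (by linarith)] at hy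
  have : |y| ≤ s + del M := abs_le.mpr ⟨hy.1, hy.2⟩
  simp only [majorF, this, if_true]
  ring

/-- The weight is continuous on `[−r, r]`. [folklore] -/
theorem continuousOn_weightW (A r : ℝ) :
    ContinuousOn (fun y => weightW M A r y) (Set.Icc (-r) r) := by
  have hδ := del_pos M
  unfold weightW
  refine ContinuousOn.div continuousOn_const (by fun_prop) fun y hy => ?_
  have : |y| ≤ r := abs_le.mpr ⟨hy.1, hy.2⟩
  have : 0 < r + del M - |y| := by linarith
  positivity

/-- **The peak term**: for `|x| ≤ s`,
`∫_{−r}^{r} w(y) J(x−y) dy ≥ (16/π⁴) · A/((M+1)³ (s + 3δ − |x|)³)`. [cite: Travaglini2014, §7.1 proof of Thm 7.2, estimate of `D_x`] -/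
theorem peak_le_integral_weight {A s x : ℝ} (hA : 0 ≤ A) (hs : 0 ≤ s) (hx : |x| ≤ s) :
    16 / π ^ 4 * (A / ((M + 1) ^ 3 * (s + 3 * del M - |x|) ^ 3)) ≤
      ∫ y in (-(s + del M))..(s + del M), weightW M A (s + del M) y * jackson M (x - y) := by
  have hδ := del_pos M
  have hM : (0 : ℝ) < M + 1 := by positivity
  set r := s + del M with hr
  set δ := del M with hδdef
  set wmin : ℝ := A / ((M + 1) ^ 3 * (s + 3 * δ - |x|) ^ 3) with hwmin
  have hden : 0 < s + 3 * δ - |x| := by linarith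
  have hwmin0 : 0 ≤ wmin := by positivity
  -- the integrand is nonnegative and continuous on `[−r, r]`
  have hcontJ : Continuous fun y => jackson M (x - y) :=
    (continuous_jackson M).comp (continuous_const.sub continuous_id)
  have hcont : ContinuousOn (fun y => weightW M A r y * jackson M (x - y)) (Set.Icc (-r) r) :=
    (continuousOn_weightW (M := M) A r).mul hcontJ.continuousOn
  have hnonneg : ∀ y ∈ Set.Icc (-r) r, 0 ≤ weightW M A r y * jackson M (x - y) := fun y hy =>
    mul_nonneg (weightW_nonneg hA (abs_le.mpr ⟨hy.1, hy.2⟩)) (jackson_nonneg M _)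
  -- restrict to `[x − δ, x + δ] ⊂ [−r, r]`
  have hsub1 : -r ≤ x - δ := by have := neg_abs_le x; linarith [hx]
  have hsub2 : x + δ ≤ r := by have := le_abs_self x; linarith [hx]
  have hstep1 : ∫ y in (x - δ)..(x + δ), weightW M A r y * jackson M (x - y) ≤
      ∫ y in (-r)..r, weightW M A r y * jackson M (x - y) := by
    refine intervalIntegral.integral_mono_interval hsub1 (by linarith) hsub2 ?_ ?_
    · rw [Filter.EventuallyLE, ae_restrict_iff' measurableSet_Ioc]
      exact Filter.Eventually.of_forall fun y hy => hnonneg y ⟨hy.1.le, hy.2⟩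
    · exact (hcont.mono (by rw [Set.uIcc_of_le (by linarith)])).intervalIntegrable
  -- on `[x − δ, x + δ]`, `w ≥ wmin`
  have hw : ∀ y ∈ Set.Icc (x - δ) (x + δ), wmin ≤ weightW M A r y := by
    intro y hy
    have hy1 : |y| ≤ |x| + δ := by
      rw [abs_le]; constructor <;> [have := neg_abs_le x; have := le_abs_self x] <;> linarith [hy.1, hy.2]
    have hy2 : |x| - δ ≤ |y| := by
      rcases le_or_gt 0 x with h | h
      · rw [abs_of_nonneg h]; have := le_abs_self y; linarith [hy.1]
      · rw [abs_of_neg h]; have := neg_abs_le y; linarith [hy.2]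
    have hpos : 0 < r + δ - |y| := by linarith
    unfold weightW
    rw [← hδdef, hwmin]
    refine div_le_div_of_nonneg_left hA (by positivity) ?_
    refine mul_le_mul_of_nonneg_left ?_ (by positivity)
    exact pow_le_pow_left₀ hpos.le (by linarith) 3
  have hstep2 : ∫ y in (x - δ)..(x + δ), wmin * jackson M (x - y) ≤
      ∫ y in (x - δ)..(x + δ), weightW M A r y * jackson M (x - y) := by
    refine intervalIntegral.integral_mono_on (by linarith)
      ((continuous_const.mul hcontJ).intervalIntegrable _ _)
      ((hcont.mono (Set.Icc_subset_Icc hsub1 hsub2)).mono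
        (by rw [Set.uIcc_of_le (by linarith)]) |>.intervalIntegrable) fun y hy => ?_
    exact mul_le_mul_of_nonneg_right (hw y hy) (jackson_nonneg M _)
  -- `∫_{x−δ}^{x+δ} J(x − y) dy = ∫_{−δ}^{δ} J ≥ 16/π⁴`
  have hstep3 : ∫ y in (x - δ)..(x + δ), wmin * jackson M (x - y) = wmin * ∫ u in (-δ)..δ, jackson M u := by
    rw [intervalIntegral.integral_const_mul, intervalIntegral.integral_comp_sub_left (fun u => jackson M u) x]
    simp only [show x - (x + δ) = -δ by ring, show x - (x - δ) = δ by ring]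
  have hpeak : 16 / π ^ 4 ≤ ∫ u in (-δ)..δ, jackson M u := by
    rw [hδdef]; exact integral_jackson_peak_ge M
  calc 16 / π ^ 4 * wmin ≤ wmin * ∫ u in (-δ)..δ, jackson M u := by
        rw [mul_comm]; exact mul_le_mul_of_nonneg_left hpeak hwmin0
    _ = ∫ y in (x - δ)..(x + δ), wmin * jackson M (x - y) := hstep3.symm
    _ ≤ _ := hstep2
    _ ≤ _ := hstep1


/-- **The tail deficit**: for `|x| ≤ s` and `r = s + δ ≤ 1/2`,
`1 − ∫_{−r}^{r} J(x−y) dy ≤ π⁴/(192 (M+1)³ (r − |x|)³)`.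
[cite: Travaglini2014, §7.1 proof of Thm 7.2, estimate of `E_x`] -/
theorem one_sub_integral_jackson_le {s x : ℝ} (hs : 0 ≤ s) (hx : |x| ≤ s)
    (hr : s + del M ≤ 1 / 2) :
    1 - (∫ y in (-(s + del M))..(s + del M), jackson M (x - y)) ≤
      π ^ 4 / (192 * (M + 1) ^ 3 * (s + del M - |x|) ^ 3) := by
  have hδ := del_pos M
  set r := s + del M with hrdef
  have ha0 : 0 < r - |x| := by linarith
  have ha : r - |x| ≤ 1 / 2 := by linarith [abs_nonneg x]
  have hxle : |x| ≤ 1 / 2 := by linarith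
  have hJ : ∀ a b : ℝ, IntervalIntegrable (fun y => jackson M (x - y)) volume a b := fun a b =>
    ((continuous_jackson M).comp (continuous_const.sub continuous_id)).intervalIntegrable _ _
  have hJ0 : ∀ y, 0 ≤ jackson M (x - y) := fun y => jackson_nonneg M _
  -- the window `[x − 1/2, x + 1/2]` and `α = max(−r, x − 1/2)`, `β = min(r, x + 1/2)`
  set α := max (-r) (x - 1 / 2) with hα
  set β := min r (x + 1 / 2) with hβ
  have hxr1 : -r ≤ x + 1 / 2 := by have := neg_abs_le x; linarith
  have hxr2 : x - 1 / 2 ≤ r := by have := le_abs_self x; linarith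
  have hαβ : α ≤ β := max_le (le_min (by linarith) hxr1) (le_min hxr2 (by linarith))
  have hwin := integral_jackson_window (M := M) x
  -- `∫_{−r}^{r} ≥ ∫_α^β`
  have h1 : ∫ y in α..β, jackson M (x - y) ≤ ∫ y in (-r)..r, jackson M (x - y) :=
    intervalIntegral.integral_mono_interval (le_max_left _ _) hαβ (min_le_left _ _)
      (Filter.Eventually.of_forall fun y => hJ0 y) (hJ _ _)
  -- split the window at `α` and `β`
  have hsplit : ∫ y in (x - 1 / 2)..(x + 1 / 2), jackson M (x - y) =
      ((∫ y in (x - 1 / 2)..α, jackson M (x - y)) + ∫ y in α..β, jackson M (x - y)) +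
        ∫ y in β..(x + 1 / 2), jackson M (x - y) := by
    rw [intervalIntegral.integral_add_adjacent_intervals (hJ _ _) (hJ _ _),
      intervalIntegral.integral_add_adjacent_intervals (hJ _ _) (hJ _ _)]
  -- left piece `= ∫_{x−α}^{1/2} J ≤ ∫_{r−|x|}^{1/2} J`
  have hleft : ∫ y in (x - 1 / 2)..α, jackson M (x - y) ≤ ∫ u in (r - |x|)..(1 / 2), jackson M u := by
    rw [intervalIntegral.integral_comp_sub_left (fun u => jackson M u) x]
    rw [show x - (x - 1 / 2) = (1 / 2 : ℝ) by ring]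
    refine intervalIntegral.integral_mono_interval ?_ ?_ le_rfl
      (Filter.Eventually.of_forall fun u => jackson_nonneg M u) ((continuous_jackson M).intervalIntegrable _ _)
    · -- `r − |x| ≤ x − α`
      rw [hα]
      rcases le_total (-r) (x - 1 / 2) with h | h
      · rw [max_eq_right h]; linarith [le_abs_self x]
      · rw [max_eq_left h]; have := neg_abs_le x; linarith
    · rw [hα]; have := le_max_right (-r) (x - 1 / 2); linarith
  -- right piece `= ∫_{−1/2}^{x−β} J ≤ ∫_{−1/2}^{−(r−|x|)} J = ∫_{r−|x|}^{1/2} J`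
  have hright : ∫ y in β..(x + 1 / 2), jackson M (x - y) ≤ ∫ u in (r - |x|)..(1 / 2), jackson M u := by
    rw [intervalIntegral.integral_comp_sub_left (fun u => jackson M u) x]
    rw [show x - (x + 1 / 2) = -(1 / 2 : ℝ) by ring]
    have hb : x - β ≤ -(r - |x|) := by
      rw [hβ]
      rcases le_total r (x + 1 / 2) with h | h
      · rw [min_eq_left h]; have := le_abs_self x; linarith
      · rw [min_eq_right h]; linarith
    calc ∫ u in (-(1 / 2 : ℝ))..(x - β), jackson M u ≤ ∫ u in (-(1 / 2 : ℝ))..(-(r - |x|)), jackson M u :=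
          intervalIntegral.integral_mono_interval le_rfl (by rw [hβ]; have := min_le_right r (x + 1/2); linarith)
            hb (Filter.Eventually.of_forall fun u => jackson_nonneg M u)
            ((continuous_jackson M).intervalIntegrable _ _)
      _ = ∫ u in (r - |x|)..(1 / 2), jackson M u := by
          rw [← intervalIntegral.integral_comp_neg (fun u => jackson M u)]
          exact intervalIntegral.integral_congr fun u _ => jackson_neg M u
  have htail := integral_jackson_tail_le (M := M) ha0 ha
  -- assemble
  have : 1 - ∫ y in (-r)..r, jackson M (x - y) ≤ 2 * ∫ u in (r - |x|)..(1 / 2), jackson M u := by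
    linarith [hwin, hsplit, h1, hleft, hright]
  refine this.trans ?_
  have hK : (0 : ℝ) < (M + 1) ^ 3 := by positivity
  have ha3 : 0 < (r - |x|) ^ 3 := by positivity
  rw [show π ^ 4 / (192 * (M + 1) ^ 3 * (r - |x|) ^ 3) = 2 * (π ^ 4 / (384 * (M + 1) ^ 3 * (r - |x|) ^ 3)) by
    field_simp; ring]
  linarith


/-- The numerical heart: `π⁸ (a + 3δ)³ ≤ 1600 · 192 (a + δ)³` for `a ≥ 0`, `δ > 0`
(since `(a+3δ)³ ≤ 27 (a+δ)³` and `27 π⁸ < 307200`). [folklore] -/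
theorem pi_pow_eight_ineq {a δ : ℝ} (ha : 0 ≤ a) (hδ : 0 < δ) :
    π ^ 4 * (π ^ 4 * (a + 3 * δ) ^ 3) ≤ 16 * 100 * (192 * (a + δ) ^ 3) := by
  have hπ : π < 3.15 := Real.pi_lt_d2
  have hπ0 : 0 < π := Real.pi_pos
  have h8 : π ^ 8 < 9694 := by
    have : π ^ 8 < (3.15 : ℝ) ^ 8 := pow_lt_pow_left₀ hπ hπ0.le (by norm_num)
    have h2 : (3.15 : ℝ) ^ 8 < 9694 := by norm_num
    linarith
  have hcube : (a + 3 * δ) ^ 3 ≤ 27 * (a + δ) ^ 3 := by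
    have h1 : a + 3 * δ ≤ 3 * (a + δ) := by linarith
    have h2 : 0 ≤ a + 3 * δ := by positivity
    calc (a + 3 * δ) ^ 3 ≤ (3 * (a + δ)) ^ 3 := pow_le_pow_left₀ h2 h1 3
      _ = 27 * (a + δ) ^ 3 := by ring
  have hpos : 0 ≤ (a + δ) ^ 3 := by positivity
  have hpos' : 0 ≤ (a + 3 * δ) ^ 3 := by positivity
  calc π ^ 4 * (π ^ 4 * (a + 3 * δ) ^ 3) = π ^ 8 * (a + 3 * δ) ^ 3 := by ring
    _ ≤ 9694 * (27 * (a + δ) ^ 3) := by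
        apply mul_le_mul h8.le hcube hpos' (by norm_num)
    _ ≤ 16 * 100 * (192 * (a + δ) ^ 3) := by nlinarith

/-- **The majorant property** (`A = 100`): for `0 ≤ s`, `s + δ ≤ 1/2` and `|x| ≤ s`,
`p⁺(x) ≥ 1`. [cite: Travaglini2014, Thm 7.2 (proof, `D_x ≥ E_x`)] -/
theorem one_le_majorP {s x : ℝ} (hs : 0 ≤ s) (hr : s + del M ≤ 1 / 2) (hx : |x| ≤ s) :
    1 ≤ majorP M 100 s x := by
  have hδ := del_pos M
  have hM : (0 : ℝ) < M + 1 := by positivity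
  rw [majorP_eq hs]
  have hpeak := peak_le_integral_weight (M := M) (A := 100) (by norm_num) hs hx
  have htail := one_sub_integral_jackson_le (M := M) hs hx hr
  -- it suffices: `tail bound ≤ peak bound`
  set a := s - |x| with ha
  have ha0 : 0 ≤ a := by rw [ha]; linarith
  have hden1 : 0 < s + 3 * del M - |x| := by linarith
  have hden2 : 0 < s + del M - |x| := by linarith
  have key : π ^ 4 / (192 * (M + 1) ^ 3 * (s + del M - |x|) ^ 3) ≤
      16 / π ^ 4 * (100 / ((M + 1) ^ 3 * (s + 3 * del M - |x|) ^ 3)) := by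
    rw [div_mul_div_comm, div_le_div_iff₀ (by positivity) (by positivity)]
    have hnum := pi_pow_eight_ineq ha0 hδ
    rw [show s + del M - |x| = a + del M by rw [ha]; ring,
      show s + 3 * del M - |x| = a + 3 * del M by rw [ha]; ring]
    have hK : (0 : ℝ) < (M + 1) ^ 3 := by positivity
    -- `π⁴ · (π⁴ K³ (a+3δ)³) ≤ 1600 · (192 K³ (a+δ)³)`
    calc π ^ 4 * (π ^ 4 * ((M + 1) ^ 3 * (a + 3 * del M) ^ 3))
        = (M + 1) ^ 3 * (π ^ 4 * (π ^ 4 * (a + 3 * del M) ^ 3)) := by ring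
      _ ≤ (M + 1) ^ 3 * (16 * 100 * (192 * (a + del M) ^ 3)) :=
          mul_le_mul_of_nonneg_left hnum hK.le
      _ = 16 * 100 * (192 * (M + 1) ^ 3 * (a + del M) ^ 3) := by ring
  linarith

/-- `p⁺ ≥ 0` everywhere (for `A ≥ 0`). [folklore] -/
theorem majorP_nonneg {A s : ℝ} (hA : 0 ≤ A) (hs : 0 ≤ s) (x : ℝ) : 0 ≤ majorP M A s x := by
  have hδ := del_pos M
  unfold majorP
  refine intervalIntegral.integral_nonneg (by linarith) fun y hy => ?_
  exact mul_nonneg (majorF_nonneg hA) (jackson_nonneg M _)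


end Majorant

/-! ## The majorant as an exponential sum -/

section ExpSum

variable (M : ℕ)

/-- The index set `Q = ([0,M] × [0,M])²` of the quadruple sum for `J_M = F_M²/c_M`. [folklore] -/
def quadIdx (M : ℕ) : Finset ((ℕ × ℕ) × (ℕ × ℕ)) :=
  (Finset.range (M + 1) ×ˢ Finset.range (M + 1)) ×ˢ (Finset.range (M + 1) ×ˢ Finset.range (M + 1))

/-- The frequency `d_q = j − k + j' − k'` of the index `q = ((j,k),(j',k'))`. [folklore] -/
def dq (q : (ℕ × ℕ) × (ℕ × ℕ)) : ℤ := ((q.1.1 : ℤ) - q.1.2) + ((q.2.1 : ℤ) - q.2.2)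

variable {M}

/-- **`J_M` as a quadruple exponential sum**: `J_M(t) = (1/(c_M (M+1)²)) Σ_q e(d_q t)`. [folklore] -/
theorem jackson_eq_sum (t : ℝ) :
    (jackson M t : ℂ) = (1 / (jacksonConst M * (M + 1) ^ 2 : ℝ) : ℂ) *
      ∑ q ∈ quadIdx M, e ((dq q : ℝ) * t) := by
  -- `F = (1/K) Σ_{p ∈ P} e((p₁ − p₂) t)`, `P = [0,M]²`
  set P := Finset.range (M + 1) ×ˢ Finset.range (M + 1) with hP
  have hF : (fejer M t : ℂ) = (1 / (M + 1 : ℂ)) * ∑ p ∈ P, e (((p.1 : ℝ) - p.2) * t) := by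
    rw [fejer_eq_double_sum, hP, Finset.sum_product]
  have hM : ((M : ℂ) + 1) ≠ 0 := by exact_mod_cast (show (M : ℝ) + 1 ≠ 0 by positivity)
  have hc : (jacksonConst M : ℂ) ≠ 0 := by exact_mod_cast (jacksonConst_pos M).ne'
  unfold jackson
  rw [Complex.ofReal_div, Complex.ofReal_pow, hF, mul_pow, sq (∑ p ∈ P, _), Finset.sum_mul_sum,
    ← Finset.sum_product']
  -- now both sides are sums over `P ×ˢ P = quadIdx M`
  have hPQ : P ×ˢ P = quadIdx M := by rw [hP]; rfl
  rw [hPQ]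
  have hterm : ∀ q ∈ quadIdx M, e (((q.1.1 : ℝ) - q.1.2) * t) * e (((q.2.1 : ℝ) - q.2.2) * t) =
      e ((dq q : ℝ) * t) := by
    intro q _
    rw [← e_add]; congr 1; simp only [dq]; push_cast; ring
  rw [Finset.sum_congr rfl hterm]
  push_cast
  field_simp
  exact Finset.sum_congr rfl fun q _ => by rw [mul_comm]

end ExpSum


section Coeffs

variable (M : ℕ)

/-- The normalising coefficient `1/(c_M (M+1)²)` of the quadruple sum. [folklore] -/
def coefC (M : ℕ) : ℝ := 1 / (jacksonConst M * (M + 1) ^ 2)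

/-- `coefC > 0`. [folklore] -/
theorem coefC_pos : 0 < coefC M := by
  unfold coefC; have := jacksonConst_pos M; positivity

/-- The Fourier coefficients `f̂(d) = ∫_{−r}^{r} (1 + w(y)) e(−dy) dy` of the weighted
indicator. [folklore] -/
def fhat (M : ℕ) (A s : ℝ) (d : ℤ) : ℂ :=
  ∫ y in (-(s + del M))..(s + del M), ((1 + weightW M A (s + del M) y : ℝ) : ℂ) * e (-(d * y))

variable {M}

/-- Continuity of `1 + w` on `[−r, r]` (complex-valued). [folklore] -/
theorem continuousOn_one_add_weightW (A r : ℝ) :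
    ContinuousOn (fun y => (((1 + weightW M A r y : ℝ)) : ℂ)) (Set.Icc (-r) r) :=
  Complex.continuous_ofReal.comp_continuousOn (continuousOn_const.add (continuousOn_weightW A r))

/-- `y ↦ e(cy)` is continuous. [folklore] -/
theorem continuous_e_mul (c : ℝ) : Continuous fun y : ℝ => e (c * y) := by
  unfold e; fun_prop

/-- `y ↦ e(−cy)` is continuous. [folklore] -/
theorem continuous_e_neg_mul (c : ℝ) : Continuous fun y : ℝ => e (-(c * y)) := by
  unfold e; fun_prop

/-- **The majorant as an exponential sum**:
`p⁺(x) = coefC · Σ_q f̂(d_q) e(d_q x)`. [cite: Travaglini2014, §7.2 proof of Thm 7.3] -/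
theorem majorP_eq_sum {A s : ℝ} (hs : 0 ≤ s) (x : ℝ) :
    (majorP M A s x : ℂ) = (coefC M : ℂ) * ∑ q ∈ quadIdx M, fhat M A s (dq q) * e ((dq q : ℝ) * x) := by
  have hδ := del_pos M
  set r := s + del M with hr
  have hr0 : 0 ≤ r := by positivity
  have hrr : -r ≤ r := by linarith
  unfold majorP
  rw [intervalIntegral.integral_ofReal.symm]  -- `↑(∫ …) = ∫ ↑…`
  -- replace `majorF` by `1 + w` on `[−r, r]` and expand `J`
  have hcongr : ∀ y ∈ Set.uIcc (-r) r, ((majorF M A s y * jackson M (x - y) : ℝ) : ℂ) =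
      (coefC M : ℂ) * ∑ q ∈ quadIdx M,
        ((((1 + weightW M A r y : ℝ)) : ℂ) * e (-((dq q : ℝ) * y))) * e ((dq q : ℝ) * x) := by
    intro y hy
    rw [Set.uIcc_of_le hrr] at hy
    have hyr : |y| ≤ r := abs_le.mpr ⟨hy.1, hy.2⟩
    have hf : majorF M A s y = 1 + weightW M A r y := by simp [majorF, ← hr, hyr]
    rw [hf, Complex.ofReal_mul, jackson_eq_sum, Finset.mul_sum, Finset.mul_sum, Finset.mul_sum]
    refine Finset.sum_congr rfl fun q _ => ?_
    rw [show ((dq q : ℝ)) * (x - y) = (dq q : ℝ) * x + -((dq q : ℝ) * y) by ring, e_add]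
    unfold coefC
    push_cast
    ring
  rw [intervalIntegral.integral_congr hcongr, intervalIntegral.integral_const_mul,
    intervalIntegral.integral_finsetSum]
  · congr 1
    refine Finset.sum_congr rfl fun q _ => ?_
    rw [intervalIntegral.integral_mul_const]
    rfl
  · intro q _
    refine (ContinuousOn.mul ?_ continuousOn_const).intervalIntegrable
    rw [Set.uIcc_of_le hrr]
    exact (continuousOn_one_add_weightW A r).mul (continuous_e_neg_mul _).continuousOn

/-- **Counting by orthogonality**: `coefC · #{q : d_q = d} = ∫₀¹ J(t) e(−dt) dt`. [folklore] -/
theorem coefC_mul_card_eq (d : ℤ) :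
    ((coefC M * ((quadIdx M).filter (fun q => dq q = d)).card : ℝ) : ℂ) =
      ∫ t in (0 : ℝ)..1, (jackson M t : ℂ) * e (-(d * t)) := by
  have h1 : ∀ t ∈ Set.uIcc (0 : ℝ) 1, (jackson M t : ℂ) * e (-(d * t)) =
      (coefC M : ℂ) * ∑ q ∈ quadIdx M, e (((dq q - d : ℤ) : ℝ) * t) := by
    intro t _
    rw [jackson_eq_sum, mul_assoc, Finset.sum_mul]
    congr 1
    · unfold coefC; push_cast; rfl
    · refine Finset.sum_congr rfl fun q _ => ?_
      rw [← e_add]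
      congr 1
      push_cast; ring
  rw [intervalIntegral.integral_congr h1, intervalIntegral.integral_const_mul,
    intervalIntegral.integral_finsetSum (fun q _ => (continuous_e_mul _).intervalIntegrable _ _)]
  have h2 : ∀ q ∈ quadIdx M, ∫ t in (0 : ℝ)..1, e (((dq q - d : ℤ) : ℝ) * t) =
      if dq q = d then 1 else 0 := by
    intro q _
    rw [integral_e_int]
    simp [sub_eq_zero]
  rw [Finset.sum_congr rfl h2, Finset.sum_boole]
  push_cast
  ring

/-- `coefC · #{q : d_q = 0} = 1`. [folklore] -/
theorem coefC_mul_card_zero :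
    coefC M * ((quadIdx M).filter (fun q => dq q = 0)).card = 1 := by
  have h := coefC_mul_card_eq (M := M) 0
  simp only [Int.cast_zero, zero_mul, neg_zero, e_zero, mul_one] at h
  rw [intervalIntegral.integral_ofReal, integral_jackson] at h
  exact_mod_cast h

/-- `coefC · #{q : d_q = d} ≤ 1` (`= |Ĵ(d)| ≤ ∫ J = 1`). [folklore] -/
theorem coefC_mul_card_le (d : ℤ) :
    coefC M * ((quadIdx M).filter (fun q => dq q = d)).card ≤ 1 := by
  have h := coefC_mul_card_eq (M := M) d
  have hn : ‖((coefC M * ((quadIdx M).filter (fun q => dq q = d)).card : ℝ) : ℂ)‖ ≤ 1 := by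
    rw [h]
    refine (intervalIntegral.norm_integral_le_integral_norm zero_le_one).trans ?_
    have : ∀ t, ‖(jackson M t : ℂ) * e (-(d * t))‖ = jackson M t := by
      intro t
      rw [norm_mul, norm_e, mul_one, Complex.norm_real, Real.norm_of_nonneg (jackson_nonneg M t)]
    simp_rw [this]
    rw [integral_jackson]
  rw [Complex.norm_real, Real.norm_of_nonneg (by have := coefC_pos M; positivity)] at hn
  exact hn

end Coeffs

section FhatBounds

variable {M : ℕ}

/-- `∫₀^r w = A/(2K³δ²) − A/(2K³(r+δ)²)` on `[0, r]` (antiderivative `A/(2K³(r+δ−y)²)`). [folklore] -/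
theorem integral_weightW_half {A r : ℝ} (hr : 0 ≤ r) :
    ∫ y in (0 : ℝ)..r, weightW M A r y =
      A / (2 * (M + 1) ^ 3 * del M ^ 2) - A / (2 * (M + 1) ^ 3 * (r + del M) ^ 2) := by
  have hδ := del_pos M
  have hM : (0 : ℝ) < M + 1 := by positivity
  have hderiv : ∀ y ∈ Set.uIcc (0 : ℝ) r,
      HasDerivAt (fun y : ℝ => A / (2 * (M + 1) ^ 3 * (r + del M - y) ^ 2)) (weightW M A r y) y := by
    intro y hy
    rw [Set.uIcc_of_le hr] at hy
    have hpos : 0 < r + del M - y := by linarith [hy.2]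
    have h1 : HasDerivAt (fun y : ℝ => r + del M - y) (-1) y := (hasDerivAt_id' y).const_sub _
    have h4 := ((h1.fun_pow 2).inv (pow_ne_zero 2 hpos.ne')).const_mul (A / (2 * (M + 1) ^ 3))
    have hfun : (fun y : ℝ => A / (2 * (M + 1) ^ 3 * (r + del M - y) ^ 2)) =
        fun y => A / (2 * (M + 1) ^ 3) * ((r + del M - y) ^ 2)⁻¹ := by
      funext y; rw [div_mul_eq_div_div, div_eq_mul_inv]
    rw [hfun]
    refine h4.congr_deriv ?_
    unfold weightW
    rw [abs_of_nonneg hy.1]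
    field_simp
    ring
  have hcont : ContinuousOn (fun y => weightW M A r y) (Set.uIcc 0 r) := by
    rw [Set.uIcc_of_le hr]
    exact (continuousOn_weightW A r).mono (Set.Icc_subset_Icc (by linarith) le_rfl)
  rw [intervalIntegral.integral_eq_sub_of_hasDerivAt hderiv hcont.intervalIntegrable]
  simp only [sub_zero, add_sub_cancel_left]

/-- `w` is even. [folklore] -/
theorem weightW_neg (A r y : ℝ) : weightW M A r (-y) = weightW M A r y := by
  unfold weightW; rw [abs_neg]

/-- **`‖w‖₁ ≤ 4A/(M+1)`**: `∫_{−r}^{r} w ≤ A/(K³δ²) = 4A/K`. [cite: Travaglini2014, §7.1 end of proof of Thm 7.2] -/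
theorem integral_weightW_le {A r : ℝ} (hA : 0 ≤ A) (hr : 0 ≤ r) :
    ∫ y in (-r)..r, weightW M A r y ≤ 4 * A / (M + 1) := by
  have hδ := del_pos M
  have hM : (0 : ℝ) < M + 1 := by positivity
  have hc : ∀ a b : ℝ, a ∈ Set.Icc (-r) r → b ∈ Set.Icc (-r) r →
      IntervalIntegrable (fun y => weightW M A r y) volume a b := fun a b ha hb =>
    ((continuousOn_weightW A r).mono (Set.uIcc_subset_Icc ha hb)).intervalIntegrable
  have h0 : (0 : ℝ) ∈ Set.Icc (-r) r := ⟨by linarith, hr⟩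
  have hrm : r ∈ Set.Icc (-r) r := ⟨by linarith, le_rfl⟩
  have hrn : -r ∈ Set.Icc (-r) r := ⟨le_rfl, by linarith⟩
  rw [← intervalIntegral.integral_add_adjacent_intervals (b := 0) (hc _ _ hrn h0) (hc _ _ h0 hrm)]
  -- `∫_{−r}^{0} w = ∫_0^r w`
  have hsym : ∫ y in (-r)..0, weightW M A r y = ∫ y in (0 : ℝ)..r, weightW M A r y := by
    rw [← neg_zero, ← intervalIntegral.integral_comp_neg (fun y => weightW M A r y)]
    simp only [neg_zero]
    exact intervalIntegral.integral_congr fun y _ => weightW_neg A r y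
  rw [hsym, integral_weightW_half hr]
  have h1 : 0 ≤ A / (2 * (M + 1) ^ 3 * (r + del M) ^ 2) := by positivity
  have h2 : A / (2 * (M + 1) ^ 3 * del M ^ 2) = 2 * A / (M + 1) := by
    unfold del; field_simp
  rw [h2]
  have h3 : 2 * A / ((M : ℝ) + 1) + 2 * A / (M + 1) = 4 * A / (M + 1) := by ring
  linarith

/-- `f̂(0) = 2r + ∫w` is real with `0 ≤ f̂(0) ≤ 2s + 2δ + 4A/(M+1)`. [folklore] -/
theorem fhat_zero_eq {A s : ℝ} (hs : 0 ≤ s) :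
    fhat M A s 0 = (((2 * (s + del M) + ∫ y in (-(s + del M))..(s + del M),
      weightW M A (s + del M) y : ℝ)) : ℂ) := by
  have hδ := del_pos M
  have hr : 0 ≤ s + del M := by positivity
  unfold fhat
  simp only [Int.cast_zero, zero_mul, neg_zero, e_zero, mul_one]
  rw [intervalIntegral.integral_ofReal, intervalIntegral.integral_add intervalIntegrable_const
    ((continuousOn_weightW A (s + del M)).mono (by rw [Set.uIcc_of_le (by linarith)])
      |>.intervalIntegrable)]
  simp only [intervalIntegral.integral_const, smul_eq_mul, mul_one]
  push_cast; ring

/-- `Re f̂(0) ≤ 2s + 2δ + 4A/(M+1)`. [folklore] -/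
theorem fhat_zero_re_le {A s : ℝ} (hA : 0 ≤ A) (hs : 0 ≤ s) :
    (fhat M A s 0).re ≤ 2 * s + 2 * del M + 4 * A / (M + 1) := by
  have hδ := del_pos M
  rw [fhat_zero_eq hs, Complex.ofReal_re]
  have := integral_weightW_le (M := M) hA (show 0 ≤ s + del M by positivity)
  linarith

/-- `Re f̂(0) ≥ 0`. [folklore] -/
theorem fhat_zero_re_nonneg {A s : ℝ} (hA : 0 ≤ A) (hs : 0 ≤ s) : 0 ≤ (fhat M A s 0).re := by
  have hδ := del_pos M
  rw [fhat_zero_eq hs, Complex.ofReal_re]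
  have : 0 ≤ ∫ y in (-(s + del M))..(s + del M), weightW M A (s + del M) y :=
    intervalIntegral.integral_nonneg (by linarith) fun y hy =>
      weightW_nonneg hA (abs_le.mpr ⟨hy.1, hy.2⟩)
  positivity

/-- `f̂(0)` is real. [folklore] -/
theorem fhat_zero_im {A s : ℝ} (hs : 0 ≤ s) : (fhat M A s 0).im = 0 := by
  rw [fhat_zero_eq hs, Complex.ofReal_im]

/-- `|∫_{−r}^{r} e(−dy) dy| ≤ 1/(π|d|)` for `d ≠ 0` (i.e. `|χ̂_I(d)| ≤ 1/(π|d|)`).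
[cite: Travaglini2014, eq. (7.7)] -/
theorem norm_integral_e_le {r : ℝ} {d : ℤ} (hd : d ≠ 0) :
    ‖∫ y in (-r)..r, e (-(d * y))‖ ≤ 1 / (π * |(d : ℝ)|) := by
  have hdR : (d : ℝ) ≠ 0 := by exact_mod_cast hd
  set c : ℂ := -(2 * π * I * d) with hc
  have hc0 : c ≠ 0 := by
    rw [hc, neg_ne_zero]
    simp [Real.pi_ne_zero, Complex.I_ne_zero, hd]
  have he : ∀ y : ℝ, e (-(d * y)) = Complex.exp (c * y) := by
    intro y; unfold e; congr 1; rw [hc]; push_cast; ring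
  simp_rw [he]
  rw [integral_exp_mul_complex hc0]
  have hnc : ‖c‖ = 2 * π * |(d : ℝ)| := by
    rw [hc, norm_neg, norm_mul, norm_mul, norm_mul, Complex.norm_I, Complex.norm_real,
      Complex.norm_intCast, Complex.norm_ofNat, Real.norm_of_nonneg Real.pi_pos.le, mul_one]
  rw [norm_div, hnc]
  have h2 : ‖Complex.exp (c * (r : ℝ)) - Complex.exp (c * ((-r : ℝ) : ℝ))‖ ≤ 2 := by
    refine (norm_sub_le _ _).trans ?_
    have h1 : ∀ t : ℝ, ‖Complex.exp (c * t)‖ = 1 := by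
      intro t
      rw [← he]; exact norm_e _
    have := h1 r; have := h1 (-r)
    push_cast at *
    linarith
  rw [div_le_div_iff₀ (by positivity) (by positivity)]
  have hp : 0 ≤ π * |(d : ℝ)| := by positivity
  calc ‖Complex.exp (c * (r : ℝ)) - Complex.exp (c * ((-r : ℝ) : ℝ))‖ * (π * |(d : ℝ)|)
      ≤ 2 * (π * |(d : ℝ)|) := mul_le_mul_of_nonneg_right h2 hp
    _ = 1 * (2 * π * |(d : ℝ)|) := by ring

/-- **`|f̂(d)| ≤ 1/(π|d|) + 4A/(M+1)` for `d ≠ 0`.** [cite: Travaglini2014, §7.2 proof of Thm 7.3] -/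
theorem norm_fhat_le {A s : ℝ} (hA : 0 ≤ A) (hs : 0 ≤ s) {d : ℤ} (hd : d ≠ 0) :
    ‖fhat M A s d‖ ≤ 1 / (π * |(d : ℝ)|) + 4 * A / (M + 1) := by
  have hδ := del_pos M
  set r := s + del M with hr
  have hr0 : 0 ≤ r := by positivity
  have hrr : -r ≤ r := by linarith
  unfold fhat
  rw [← hr]
  have hi1 : IntervalIntegrable (fun y : ℝ => e (-(d * y))) volume (-r) r :=
    (continuous_e_neg_mul _).intervalIntegrable _ _
  have hi2 : IntervalIntegrable (fun y : ℝ => ((weightW M A r y : ℝ) : ℂ) * e (-(d * y))) volume (-r) r := by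
    refine (ContinuousOn.mul ?_ (continuous_e_neg_mul _).continuousOn).intervalIntegrable
    rw [Set.uIcc_of_le hrr]
    exact Complex.continuous_ofReal.comp_continuousOn (continuousOn_weightW A r)
  have hsplit : ∫ y in (-r)..r, ((1 + weightW M A r y : ℝ) : ℂ) * e (-(d * y)) =
      (∫ y in (-r)..r, e (-(d * y))) + ∫ y in (-r)..r, ((weightW M A r y : ℝ) : ℂ) * e (-(d * y)) := by
    rw [← intervalIntegral.integral_add hi1 hi2]
    refine intervalIntegral.integral_congr fun y _ => ?_
    push_cast; ring
  rw [hsplit]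
  refine (norm_add_le _ _).trans (add_le_add (norm_integral_e_le hd) ?_)
  -- `‖∫ w e‖ ≤ ∫ w ≤ 4A/K`
  refine (intervalIntegral.norm_integral_le_integral_norm hrr).trans ?_
  have : ∀ y ∈ Set.uIcc (-r) r, ‖((weightW M A r y : ℝ) : ℂ) * e (-(d * y))‖ = weightW M A r y := by
    intro y hy
    rw [Set.uIcc_of_le hrr] at hy
    rw [norm_mul, norm_e, mul_one, Complex.norm_real,
      Real.norm_of_nonneg (weightW_nonneg hA (abs_le.mpr ⟨hy.1, hy.2⟩))]
  rw [intervalIntegral.integral_congr this]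
  exact integral_weightW_le hA hr0

end FhatBounds

section PointSums

variable {M : ℕ} {N : ℕ}

/-- The exponential sums `S(d) = Σ_n e(d ω_n)` of a point set. [folklore] -/
def expSum (ω : Fin N → ℝ) (d : ℤ) : ℂ := ∑ n, e (d * ω n)

/-- `S(0) = N`. [folklore] -/
theorem expSum_zero (ω : Fin N → ℝ) : expSum ω 0 = N := by
  unfold expSum; simp [e_zero]

/-- `|S(d)| ≤ N`. [folklore] -/
theorem norm_expSum_le (ω : Fin N → ℝ) (d : ℤ) : ‖expSum ω d‖ ≤ N := by
  unfold expSum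
  calc ‖∑ n, e (d * ω n)‖ ≤ ∑ n : Fin N, ‖e (d * ω n)‖ := norm_sum_le _ _
    _ = N := by simp [norm_e]

/-- **Summing the majorant over the points**:
`Σ_n p⁺(ω_n − m) = coefC Σ_q f̂(d_q) e(−d_q m) S(d_q)`. [cite: Travaglini2014, §7.2 proof of Thm 7.3] -/
theorem sum_majorP_eq (ω : Fin N → ℝ) (m : ℝ) {A s : ℝ} (hs : 0 ≤ s) :
    ((∑ n, majorP M A s (ω n - m) : ℝ) : ℂ) =
      (coefC M : ℂ) * ∑ q ∈ quadIdx M, fhat M A s (dq q) * (e (-((dq q : ℝ) * m)) * expSum ω (dq q)) := by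
  push_cast
  simp_rw [majorP_eq_sum hs]
  rw [← Finset.mul_sum, Finset.sum_comm]
  congr 1
  refine Finset.sum_congr rfl fun q _ => ?_
  unfold expSum
  simp only [Finset.mul_sum]
  refine Finset.sum_congr rfl fun n _ => ?_
  rw [show (dq q : ℝ) * (ω n - m) = -((dq q : ℝ) * m) + (dq q : ℝ) * ω n by ring, e_add]

/-- Regrouping the quadruple sum by frequency, with the multiplicity bound
`coefC · #{q : d_q = d} ≤ 1`: for `g ≥ 0`,
`coefC Σ_{q : d_q ≠ 0} g(d_q) ≤ Σ_{0 < |d| ≤ 2M} g(d)`. [folklore] -/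
theorem coefC_sum_le (g : ℤ → ℝ) (hg : ∀ d, 0 ≤ g d) :
    coefC M * ∑ q ∈ (quadIdx M).filter (fun q => dq q ≠ 0), g (dq q) ≤
      ∑ d ∈ (Finset.Icc (-(2 * M : ℤ)) (2 * M)).filter (fun d => d ≠ 0), g d := by
  set Q' := (quadIdx M).filter (fun q => dq q ≠ 0) with hQ'
  set T := (Finset.Icc (-(2 * M : ℤ)) (2 * M)).filter (fun d => d ≠ 0) with hT
  have hmaps : ∀ q ∈ Q', dq q ∈ T := by
    intro q hq
    rw [hQ', Finset.mem_filter] at hq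
    obtain ⟨hqQ, hq0⟩ := hq
    rw [hT, Finset.mem_filter, Finset.mem_Icc]
    refine ⟨?_, hq0⟩
    unfold quadIdx at hqQ
    simp only [Finset.mem_product, Finset.mem_range] at hqQ
    obtain ⟨⟨h1, h2⟩, h3, h4⟩ := hqQ
    simp only [dq]
    constructor <;> omega
  rw [← Finset.sum_fiberwise_of_maps_to hmaps, Finset.mul_sum]
  refine Finset.sum_le_sum fun d hd => ?_
  have hinner : ∑ q ∈ Q'.filter (fun q => dq q = d), g (dq q) =
      (Q'.filter (fun q => dq q = d)).card * g d := by
    rw [Finset.sum_congr rfl (fun q hq => by rw [(Finset.mem_filter.mp hq).2]), Finset.sum_const,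
      nsmul_eq_mul]
  rw [hinner, ← mul_assoc]
  have hcard : ((Q'.filter (fun q => dq q = d)).card : ℝ) ≤ ((quadIdx M).filter (fun q => dq q = d)).card := by
    exact_mod_cast Finset.card_le_card (Finset.filter_subset_filter _ (Finset.filter_subset _ _))
  have hc0 := coefC_pos M
  calc coefC M * ((Q'.filter (fun q => dq q = d)).card : ℝ) * g d
      ≤ coefC M * ((quadIdx M).filter (fun q => dq q = d)).card * g d := by
        apply mul_le_mul_of_nonneg_right _ (hg d)
        exact mul_le_mul_of_nonneg_left hcard hc0.le
    _ ≤ 1 * g d := mul_le_mul_of_nonneg_right (coefC_mul_card_le d) (hg d)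
    _ = g d := one_mul _

/-- **The majorant count bound**:
`Σ_n p⁺(ω_n − m) ≤ (2s + 2δ + 4A/(M+1)) N + Σ_{0<|d|≤2M} (1/(π|d|) + 4A/(M+1)) |S(d)|`.
[cite: Travaglini2014, §7.2 proof of Thm 7.3] -/
theorem sum_majorP_le (ω : Fin N → ℝ) (m : ℝ) {A s : ℝ} (hA : 0 ≤ A) (hs : 0 ≤ s) :
    ∑ n, majorP M A s (ω n - m) ≤ (2 * s + 2 * del M + 4 * A / (M + 1)) * N +
      ∑ d ∈ (Finset.Icc (-(2 * M : ℤ)) (2 * M)).filter (fun d => d ≠ 0),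
        (1 / (π * |(d : ℝ)|) + 4 * A / (M + 1)) * ‖expSum ω d‖ := by
  have hid := sum_majorP_eq (M := M) ω m (A := A) hs
  -- split the frequency `0`
  rw [← Finset.sum_filter_add_sum_filter_not (quadIdx M) (fun q => dq q = 0), mul_add] at hid
  -- the zero part is `f̂(0) N`
  have hzero : (coefC M : ℂ) * ∑ q ∈ (quadIdx M).filter (fun q => dq q = 0),
      fhat M A s (dq q) * (e (-((dq q : ℝ) * m)) * expSum ω (dq q)) = fhat M A s 0 * N := by
    rw [Finset.sum_congr rfl (fun q hq => by rw [(Finset.mem_filter.mp hq).2]), Finset.sum_const,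
      nsmul_eq_mul]
    simp only [Int.cast_zero, zero_mul, neg_zero, e_zero, one_mul, expSum_zero]
    have h1 := coefC_mul_card_zero (M := M)
    calc (coefC M : ℂ) * ((((quadIdx M).filter (fun q => dq q = 0)).card : ℂ) * (fhat M A s 0 * N))
        = ((coefC M * ((quadIdx M).filter (fun q => dq q = 0)).card : ℝ) : ℂ) * (fhat M A s 0 * N) := by
          push_cast; ring
      _ = fhat M A s 0 * N := by rw [h1]; push_cast; ring
  rw [hzero] at hid
  -- take real parts
  have hre : ∑ n, majorP M A s (ω n - m) = ((fhat M A s 0 * N +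
      (coefC M : ℂ) * ∑ q ∈ (quadIdx M).filter (fun q => ¬dq q = 0),
        fhat M A s (dq q) * (e (-((dq q : ℝ) * m)) * expSum ω (dq q))).re) := by
    rw [← hid, Complex.ofReal_re]
  rw [hre, Complex.add_re]
  have h1 : (fhat M A s 0 * (N : ℂ)).re ≤ (2 * s + 2 * del M + 4 * A / (M + 1)) * N := by
    rw [Complex.mul_re, Complex.natCast_re, Complex.natCast_im, mul_zero, sub_zero]
    exact mul_le_mul_of_nonneg_right (fhat_zero_re_le hA hs) (Nat.cast_nonneg N)
  have h2 : ((coefC M : ℂ) * ∑ q ∈ (quadIdx M).filter (fun q => ¬dq q = 0),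
      fhat M A s (dq q) * (e (-((dq q : ℝ) * m)) * expSum ω (dq q))).re ≤
      ∑ d ∈ (Finset.Icc (-(2 * M : ℤ)) (2 * M)).filter (fun d => d ≠ 0),
        (1 / (π * |(d : ℝ)|) + 4 * A / (M + 1)) * ‖expSum ω d‖ := by
    refine (Complex.re_le_norm _).trans ?_
    rw [norm_mul, Complex.norm_real, Real.norm_of_nonneg (coefC_pos M).le]
    have hg : ∀ d : ℤ, 0 ≤ (1 / (π * |(d : ℝ)|) + 4 * A / (M + 1)) * ‖expSum ω d‖ := fun d => by
      positivity
    refine le_trans ?_ (coefC_sum_le (M := M) _ hg)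
    refine mul_le_mul_of_nonneg_left ?_ (coefC_pos M).le
    have : (quadIdx M).filter (fun q => ¬dq q = 0) = (quadIdx M).filter (fun q => dq q ≠ 0) := rfl
    rw [this]
    refine (norm_sum_le _ _).trans (Finset.sum_le_sum fun q hq => ?_)
    have hq0 : dq q ≠ 0 := (Finset.mem_filter.mp hq).2
    rw [norm_mul, norm_mul, norm_e, one_mul]
    exact mul_le_mul_of_nonneg_right (norm_fhat_le hA hs hq0) (norm_nonneg _)
  linarith

end PointSums

/-! ## The Erdős–Turán inequality -/

section ErdosTuran

variable {M N : ℕ}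

/-- Distance to the nearest integer. [folklore] -/
def distZ (t : ℝ) : ℝ := |t - round t|

/-- `‖t‖ ≤ |t − k|` for every integer `k`. [folklore] -/
theorem distZ_le_abs_sub_int (t : ℝ) (k : ℤ) : distZ t ≤ |t - k| := round_le t k

/-- `‖t‖ ≥ 0`. [folklore] -/
theorem distZ_nonneg (t : ℝ) : 0 ≤ distZ t := abs_nonneg _

/-- `p⁺` is `1`-periodic. [folklore] -/
theorem majorP_add_int (A s x : ℝ) (k : ℤ) : majorP M A s (x + k) = majorP M A s x := by
  unfold majorP
  refine intervalIntegral.integral_congr fun y _ => ?_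
  rw [show x + k - y = (x - y) + k by ring, jackson_add_int]

/-- **`p⁺ ≥ 1` on the arc `{distZ ≤ s}`** (for `s + δ ≤ 1/2`). [folklore] -/
theorem one_le_majorP_of_distZ {s t : ℝ} (hs : 0 ≤ s) (hr : s + del M ≤ 1 / 2)
    (ht : distZ t ≤ s) : 1 ≤ majorP M 100 s t := by
  have h := majorP_add_int (M := M) 100 s (t - round t) (round t)
  rw [sub_add_cancel] at h
  rw [h]
  exact one_le_majorP hs hr ht

/-- Counting with a nonnegative majorant: if `p ≥ 0` and `p ≥ 1` on the marked points then
`#marked ≤ Σ p`. [folklore] -/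
theorem card_le_sum_of_majorant {p : Fin N → ℝ} {P : Fin N → Prop} [DecidablePred P]
    (hp0 : ∀ n, 0 ≤ p n) (hp1 : ∀ n, P n → 1 ≤ p n) :
    (((Finset.univ : Finset (Fin N)).filter P).card : ℝ) ≤ ∑ n, p n := by
  calc (((Finset.univ : Finset (Fin N)).filter P).card : ℝ)
      = ∑ n ∈ (Finset.univ : Finset (Fin N)).filter P, (1 : ℝ) := by simp
    _ ≤ ∑ n ∈ (Finset.univ : Finset (Fin N)).filter P, p n :=
        Finset.sum_le_sum fun n hn => hp1 n (Finset.mem_filter.mp hn).2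
    _ ≤ ∑ n, p n :=
        Finset.sum_le_sum_of_subset_of_nonneg (Finset.filter_subset _ _) fun n _ _ => hp0 n

/-- The error functional `E(ω) = Σ_{0<|d|≤2M} (1/(π|d|) + 400/(M+1)) |S(d)|`. [folklore] -/
def errET (M : ℕ) (ω : Fin N → ℝ) : ℝ :=
  ∑ d ∈ (Finset.Icc (-(2 * M : ℤ)) (2 * M)).filter (fun d => d ≠ 0),
    (1 / (π * |(d : ℝ)|) + 4 * 100 / (M + 1)) * ‖expSum ω d‖

/-- `E(ω) ≥ 0`. [folklore] -/
theorem errET_nonneg (ω : Fin N → ℝ) : 0 ≤ errET M ω :=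
  Finset.sum_nonneg fun d _ => by unfold expSum; positivity

/-- **Upper arc count**: `#{n : distZ(ω_n − m) ≤ s} ≤ (2s + 2δ + 400/(M+1)) N + E(ω)` for all
`s ≥ 0`. [cite: Travaglini2014, §7.2 proof of Thm 7.3] -/
theorem arcCount_le (ω : Fin N → ℝ) (m : ℝ) {s : ℝ} (hs : 0 ≤ s) :
    (((Finset.univ : Finset (Fin N)).filter (fun n => distZ (ω n - m) ≤ s)).card : ℝ) ≤
      (2 * s + 2 * del M + 4 * 100 / (M + 1)) * N + errET M ω := by
  have hδ := del_pos M
  have hE := errET_nonneg (M := M) ω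
  by_cases hr : s + del M ≤ 1 / 2
  · calc (((Finset.univ : Finset (Fin N)).filter (fun n => distZ (ω n - m) ≤ s)).card : ℝ)
        ≤ ∑ n, majorP M 100 s (ω n - m) :=
          card_le_sum_of_majorant (fun n => majorP_nonneg (by norm_num) hs _)
            fun n hn => one_le_majorP_of_distZ hs hr hn
      _ ≤ _ := sum_majorP_le ω m (by norm_num) hs
  · -- trivial regime: `2s + 2δ > 1`
    push Not at hr
    have hcard : (((Finset.univ : Finset (Fin N)).filter (fun n => distZ (ω n - m) ≤ s)).card : ℝ) ≤ N := by
      exact_mod_cast (Finset.card_filter_le _ _).trans (Finset.card_fin N).le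
    have hN : (0 : ℝ) ≤ N := Nat.cast_nonneg N
    have : (N : ℝ) ≤ (2 * s + 2 * del M + 4 * 100 / (M + 1)) * N := by
      have h1 : (1 : ℝ) ≤ 2 * s + 2 * del M + 4 * 100 / (M + 1) := by
        have : (0 : ℝ) ≤ 4 * 100 / (M + 1) := by positivity
        linarith
      nlinarith
    linarith

/-- **Lower arc count** via the complementary arc: for `0 ≤ s ≤ 1/2`,
`#{n : distZ(ω_n − m) ≤ s} ≥ 2 s N − (2δ + 400/(M+1)) N − E(ω)`. [folklore] -/
theorem le_arcCount (ω : Fin N → ℝ) (m : ℝ) {s : ℝ} (hs2 : s ≤ 1 / 2) :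
    2 * s * N - (2 * del M + 4 * 100 / (M + 1)) * N - errET M ω ≤
      (((Finset.univ : Finset (Fin N)).filter (fun n => distZ (ω n - m) ≤ s)).card : ℝ) := by
  -- points off the arc lie on the complementary arc (centre `m + 1/2`, half-length `1/2 − s`)
  have hcomp : ∀ n, ¬ distZ (ω n - m) ≤ s → distZ (ω n - (m + 1 / 2)) ≤ 1 / 2 - s := by
    intro n hn
    push Not at hn
    set t := ω n - m with ht
    have h1 : distZ t ≤ 1 / 2 := abs_sub_round t
    -- `|t − round t| > s`; the nearest integer to `t − 1/2` is `round t` or `round t − 1`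
    unfold distZ at hn h1 ⊢
    rw [show ω n - (m + 1 / 2) = t - 1 / 2 by rw [ht]; ring]
    rcases le_or_gt 0 (t - round t) with hpos | hneg
    · -- `t − round t ∈ (s, 1/2]`: compare with the integer `round t`
      have := round_le (t - 1 / 2) (round t)
      rw [abs_of_nonneg hpos] at hn h1
      refine this.trans ?_
      rw [abs_le]; constructor <;> linarith
    · have := round_le (t - 1 / 2) (round t - 1)
      rw [abs_of_neg hneg] at hn h1
      refine this.trans ?_
      push_cast
      rw [abs_le]; constructor <;> linarith
  have hU := arcCount_le (M := M) ω (m + 1 / 2) (s := 1 / 2 - s) (by linarith)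
  -- `N − #arc ≤ #comp`
  have hsplit : (((Finset.univ : Finset (Fin N)).filter (fun n => distZ (ω n - m) ≤ s)).card : ℝ) +
      (((Finset.univ : Finset (Fin N)).filter (fun n => ¬ distZ (ω n - m) ≤ s)).card : ℝ) = N := by
    have := Finset.card_filter_add_card_filter_not (s := (Finset.univ : Finset (Fin N)))
      (fun n => distZ (ω n - m) ≤ s)
    rw [Finset.card_fin] at this
    exact_mod_cast this
  have hmono : (((Finset.univ : Finset (Fin N)).filter (fun n => ¬ distZ (ω n - m) ≤ s)).card : ℝ) ≤
      ((Finset.univ : Finset (Fin N)).filter (fun n => distZ (ω n - (m + 1 / 2)) ≤ 1 / 2 - s)).card := by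
    exact_mod_cast Finset.card_le_card (fun n hn => Finset.mem_filter.mpr
      ⟨Finset.mem_univ _, hcomp n (Finset.mem_filter.mp hn).2⟩)
  linarith

/-- **The arc form of the Erdős–Turán inequality** (explicit constants): for `0 ≤ s ≤ 1/2`,
`|#{n : ‖ω_n − m‖ ≤ s} − 2sN| ≤ (1 + 400)/(M+1) · N + Σ_{0<|d|≤2M} (1/(π|d|) + 400/(M+1)) |S(d)|`.
[cite: Travaglini2014, Thm 7.3] -/
theorem abs_arcCount_sub_le (ω : Fin N → ℝ) (m : ℝ) {s : ℝ} (hs : 0 ≤ s) (hs2 : s ≤ 1 / 2) :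
    abs ((((Finset.univ : Finset (Fin N)).filter (fun n => distZ (ω n - m) ≤ s)).card : ℝ) - 2 * s * N) ≤
      401 / (M + 1) * N + errET M ω := by
  have hU := arcCount_le (M := M) ω m hs
  have hL := le_arcCount (M := M) ω m hs2
  have hδ : 2 * del M = 1 / (M + 1) := by unfold del; field_simp
  rw [abs_le]
  constructor
  · have : (2 * del M + 4 * 100 / (M + 1)) * N = 401 / (M + 1) * N := by rw [hδ]; ring
    linarith
  · have : (2 * s + 2 * del M + 4 * 100 / (M + 1)) * N = 2 * s * N + 401 / (M + 1) * N := by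
      rw [show 2 * s + 2 * del M + 4 * 100 / ((M : ℝ) + 1) = 2 * s + (2 * del M + 4 * 100 / (M + 1)) by ring,
        hδ]; ring
    linarith

end ErdosTuran

section Classical

variable {N : ℕ}

/-- `S(−d) = conj S(d)`. [folklore] -/
theorem expSum_neg (ω : Fin N → ℝ) (d : ℤ) : expSum ω (-d) = (starRingEnd ℂ) (expSum ω d) := by
  unfold expSum
  rw [map_sum]
  refine Finset.sum_congr rfl fun n _ => ?_
  rw [← e_neg]; congr 1; push_cast; ring

/-- `|S(−d)| = |S(d)|`. [folklore] -/
theorem norm_expSum_neg (ω : Fin N → ℝ) (d : ℤ) : ‖expSum ω (-d)‖ = ‖expSum ω d‖ := by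
  rw [expSum_neg, Complex.norm_conj]

/-- Passing from `Σ_{0<|d|≤2M}` to `2 Σ_{d=1}^{H}` with `M = ⌊H/2⌋`:
`E(ω) ≤ (2/π + 1600) Σ_{d=1}^{H} |S(d)|/d`. [folklore] -/
theorem errET_le {H : ℕ} (hH : 1 ≤ H) (ω : Fin N → ℝ) :
    errET (H / 2) ω ≤ (2 / π + 1600) * ∑ d ∈ Finset.Icc 1 H, ‖expSum ω d‖ / d := by
  set M := H / 2 with hM
  have hMH : 2 * M ≤ H := by omega
  have hK : ((H : ℝ) + 1) / 2 ≤ (M : ℝ) + 1 := by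
    have : H + 1 ≤ 2 * (M + 1) := by omega
    have : ((H : ℝ) + 1) ≤ 2 * ((M : ℝ) + 1) := by exact_mod_cast this
    linarith
  have hH0 : (0 : ℝ) < H := by exact_mod_cast hH
  unfold errET
  -- each summand `≤ (1/π + 800)/|d| · |S d|`, and the index set embeds in `0 < |d| ≤ H`
  set T := (Finset.Icc (-(H : ℤ)) H).filter (fun d => d ≠ 0) with hT
  have hsub : (Finset.Icc (-(2 * M : ℤ)) (2 * M)).filter (fun d => d ≠ 0) ⊆ T := by
    intro d hd
    rw [Finset.mem_filter, Finset.mem_Icc] at hd ⊢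
    refine ⟨⟨?_, ?_⟩, hd.2⟩ <;> omega
  have hterm : ∀ d ∈ T, (1 / (π * |(d : ℝ)|) + 4 * 100 / ((M : ℝ) + 1)) * ‖expSum ω d‖ ≤
      (1 / π + 800) / |(d : ℝ)| * ‖expSum ω d‖ := by
    intro d hd
    rw [hT, Finset.mem_filter, Finset.mem_Icc] at hd
    have hd0 : (0 : ℝ) < |(d : ℝ)| := abs_pos.mpr (by exact_mod_cast hd.2)
    have hdH : |(d : ℝ)| ≤ H := by
      rw [abs_le]; constructor <;> exact_mod_cast (by omega)
    refine mul_le_mul_of_nonneg_right ?_ (norm_nonneg _)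
    rw [add_div, div_div]
    refine add_le_add le_rfl ?_
    -- `400/(M+1) ≤ 800/(H+1) ≤ 800/|d|`
    rw [div_le_div_iff₀ (by positivity) hd0]
    nlinarith
  calc ∑ d ∈ (Finset.Icc (-(2 * M : ℤ)) (2 * M)).filter (fun d => d ≠ 0),
        (1 / (π * |(d : ℝ)|) + 4 * 100 / ((M : ℝ) + 1)) * ‖expSum ω d‖
      ≤ ∑ d ∈ T, (1 / (π * |(d : ℝ)|) + 4 * 100 / ((M : ℝ) + 1)) * ‖expSum ω d‖ :=
        Finset.sum_le_sum_of_subset_of_nonneg hsub fun d _ _ => by positivity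
    _ ≤ ∑ d ∈ T, (1 / π + 800) / |(d : ℝ)| * ‖expSum ω d‖ := Finset.sum_le_sum hterm
    _ = (2 / π + 1600) * ∑ d ∈ Finset.Icc 1 H, ‖expSum ω d‖ / d := by
        -- split `T` into negative and positive frequencies
        have hTsplit : T = (Finset.Icc 1 (H : ℤ)) ∪ (Finset.Icc 1 (H : ℤ)).image (fun d => -d) := by
          ext d
          rw [hT, Finset.mem_filter, Finset.mem_Icc, Finset.mem_union, Finset.mem_Icc, Finset.mem_image]
          constructor
          · rintro ⟨⟨h1, h2⟩, h0⟩
            rcases lt_or_gt_of_ne h0 with h | h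
            · right; exact ⟨-d, Finset.mem_Icc.mpr ⟨by omega, by omega⟩, by ring⟩
            · left; exact ⟨by omega, h2⟩
          · rintro (⟨h1, h2⟩ | ⟨d', hd', rfl⟩)
            · exact ⟨⟨by omega, h2⟩, by omega⟩
            · rw [Finset.mem_Icc] at hd'; exact ⟨⟨by omega, by omega⟩, by omega⟩
        have hdisj : Disjoint (Finset.Icc 1 (H : ℤ)) ((Finset.Icc 1 (H : ℤ)).image (fun d => -d)) := by
          rw [Finset.disjoint_left]
          intro d hd hd'
          rw [Finset.mem_Icc] at hd
          rw [Finset.mem_image] at hd'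
          obtain ⟨d', hd', rfl⟩ := hd'
          rw [Finset.mem_Icc] at hd'
          omega
        rw [hTsplit, Finset.sum_union hdisj, Finset.sum_image (fun a _ b _ h => neg_injective h)]
        -- the two halves agree
        have hneg : ∀ d ∈ Finset.Icc 1 (H : ℤ), (1 / π + 800) / |((-d : ℤ) : ℝ)| * ‖expSum ω (-d)‖ =
            (1 / π + 800) / |(d : ℝ)| * ‖expSum ω d‖ := by
          intro d _
          rw [norm_expSum_neg]; push_cast; rw [abs_neg]
        rw [Finset.sum_congr rfl hneg, ← two_mul, Finset.mul_sum, Finset.mul_sum]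
        -- reindex the `ℕ`-sum on the right as a `ℤ`-sum over `Icc 1 H`
        have himg : (Finset.Icc 1 H).image (fun d : ℕ => (d : ℤ)) = Finset.Icc 1 (H : ℤ) := by
          ext d
          rw [Finset.mem_image, Finset.mem_Icc]
          constructor
          · rintro ⟨d', hd', rfl⟩; rw [Finset.mem_Icc] at hd'
            exact ⟨by exact_mod_cast hd'.1, by exact_mod_cast hd'.2⟩
          · rintro ⟨h1, h2⟩
            exact ⟨d.toNat, Finset.mem_Icc.mpr ⟨by omega, by omega⟩, by omega⟩
        have hR : ∑ d ∈ Finset.Icc 1 H, (2 / π + 1600) * (‖expSum ω d‖ / d) =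
            ∑ i ∈ Finset.Icc 1 (H : ℤ), (2 / π + 1600) * (‖expSum ω i‖ / (i : ℝ)) := by
          rw [← himg, Finset.sum_image (fun a _ b _ h => by exact_mod_cast h)]
          refine Finset.sum_congr rfl fun d _ => ?_
          push_cast
          rfl
        rw [hR]
        refine Finset.sum_congr rfl fun d hd => ?_
        rw [Finset.mem_Icc] at hd
        have hd0 : (0 : ℝ) < d := by exact_mod_cast (show (0 : ℤ) < d by omega)
        rw [abs_of_pos hd0]
        field_simp
        ring

/-- **The Erdős–Turán inequality, arc form**: for `N` points `ω_n ∈ ℝ/ℤ`, every arc (centre `m`,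
half-length `0 ≤ s ≤ 1/2`) and every `H ≥ 1`,
`|#{n : ‖ω_n − m‖ ≤ s} − 2sN| ≤ 802 N/H + (2/π + 1600) Σ_{d=1}^{H} |Σ_n e(dω_n)|/d`.
[cite: Travaglini2014, Thm 7.3 (with an explicit absolute constant)] -/
theorem erdosTuran_arc (ω : Fin N → ℝ) (m : ℝ) {s : ℝ} (hs : 0 ≤ s) (hs2 : s ≤ 1 / 2)
    {H : ℕ} (hH : 1 ≤ H) :
    abs ((((Finset.univ : Finset (Fin N)).filter (fun n => distZ (ω n - m) ≤ s)).card : ℝ) - 2 * s * N) ≤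
      802 * N / H + (2 / π + 1600) * ∑ d ∈ Finset.Icc 1 H, ‖expSum ω d‖ / d := by
  have h1 := abs_arcCount_sub_le (M := H / 2) ω m hs hs2
  have h2 := errET_le hH ω
  have hH0 : (0 : ℝ) < H := by exact_mod_cast hH
  have hK : 401 / ((H / 2 : ℕ) + 1 : ℝ) * N ≤ 802 * N / H := by
    have : (H : ℝ) ≤ 2 * ((H / 2 : ℕ) + 1 : ℝ) := by
      have : H ≤ 2 * (H / 2 + 1) := by omega
      exact_mod_cast this
    rw [div_mul_eq_mul_div, div_le_div_iff₀ (by positivity) hH0]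
    have hN : (0 : ℝ) ≤ N := Nat.cast_nonneg N
    nlinarith
  linarith

/-- **The Erdős–Turán inequality for intervals**: for `0 ≤ a ≤ b ≤ 1` and `H ≥ 1`,
`|#{n : a ≤ {ω_n} < b} − (b−a)N| ≤ 802 N/H + (2/π + 1600) Σ_{d=1}^{H} |Σ_n e(dω_n)|/d`.
[cite: Travaglini2014, Thm 7.3; CalegariDimitrovTang2024, §4.2 eq. (Erdős–Turán)] -/
theorem erdosTuran (ω : Fin N → ℝ) {a b : ℝ} (ha : 0 ≤ a) (hab : a ≤ b) (hb : b ≤ 1)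
    {H : ℕ} (hH : 1 ≤ H) :
    abs ((((Finset.univ : Finset (Fin N)).filter
        (fun n => a ≤ Int.fract (ω n) ∧ Int.fract (ω n) < b)).card : ℝ) - (b - a) * N) ≤
      802 * N / H + (2 / π + 1600) * ∑ d ∈ Finset.Icc 1 H, ‖expSum ω d‖ / d := by
  set m : ℝ := (a + b) / 2 with hm
  set s : ℝ := (b - a) / 2 with hsdef
  have hs : 0 ≤ s := by rw [hsdef]; linarith
  have hs2 : s ≤ 1 / 2 := by rw [hsdef]; linarith
  -- upper: the interval is inside the arc `(m, s)`
  have hup : (((Finset.univ : Finset (Fin N)).filter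
      (fun n => a ≤ Int.fract (ω n) ∧ Int.fract (ω n) < b)).card : ℝ) ≤
      (((Finset.univ : Finset (Fin N)).filter (fun n => distZ (ω n - m) ≤ s)).card : ℝ) := by
    exact_mod_cast Finset.card_le_card fun n hn => by
      rw [Finset.mem_filter] at hn ⊢
      refine ⟨hn.1, ?_⟩
      obtain ⟨h1, h2⟩ := hn.2
      refine (distZ_le_abs_sub_int _ ⌊ω n⌋).trans ?_
      rw [show ω n - m - (⌊ω n⌋ : ℤ) = Int.fract (ω n) - m by rw [Int.fract]; ring, abs_le]
      constructor <;> [rw [hm]; rw [hm, hsdef]] <;> linarith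
  -- lower: the complement is inside the arc `(m + 1/2, 1/2 − s)`
  have hlow : (((Finset.univ : Finset (Fin N)).filter
      (fun n => ¬ (a ≤ Int.fract (ω n) ∧ Int.fract (ω n) < b))).card : ℝ) ≤
      (((Finset.univ : Finset (Fin N)).filter (fun n => distZ (ω n - (m + 1 / 2)) ≤ 1 / 2 - s)).card : ℝ) := by
    exact_mod_cast Finset.card_le_card fun n hn => by
      rw [Finset.mem_filter] at hn ⊢
      refine ⟨hn.1, ?_⟩
      have hf0 := Int.fract_nonneg (ω n)
      have hf1 := Int.fract_lt_one (ω n)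
      rcases not_and_or.mp hn.2 with h | h
      · push Not at h
        refine (distZ_le_abs_sub_int _ (⌊ω n⌋ - 1)).trans ?_
        rw [show ω n - (m + 1 / 2) - ((⌊ω n⌋ - 1 : ℤ) : ℝ) = Int.fract (ω n) - (m - 1 / 2) by
          rw [Int.fract]; push_cast; ring, abs_le]
        constructor <;> [rw [hm, hsdef]; rw [hm, hsdef]] <;> linarith
      · push Not at h
        refine (distZ_le_abs_sub_int _ ⌊ω n⌋).trans ?_
        rw [show ω n - (m + 1 / 2) - (⌊ω n⌋ : ℤ) = Int.fract (ω n) - (m + 1 / 2) by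
          rw [Int.fract]; ring, abs_le]
        constructor <;> [rw [hm, hsdef]; rw [hm, hsdef]] <;> linarith
  have hsplit : (((Finset.univ : Finset (Fin N)).filter
      (fun n => a ≤ Int.fract (ω n) ∧ Int.fract (ω n) < b)).card : ℝ) +
      (((Finset.univ : Finset (Fin N)).filter
        (fun n => ¬ (a ≤ Int.fract (ω n) ∧ Int.fract (ω n) < b))).card : ℝ) = N := by
    have := Finset.card_filter_add_card_filter_not (s := (Finset.univ : Finset (Fin N)))
      (fun n => a ≤ Int.fract (ω n) ∧ Int.fract (ω n) < b)
    rw [Finset.card_fin] at this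
    exact_mod_cast this
  have hU := arcCount_le (M := H / 2) ω m hs
  have hU' := arcCount_le (M := H / 2) ω (m + 1 / 2) (s := 1 / 2 - s) (by linarith)
  have hE := errET_le hH ω
  have hH0 : (0 : ℝ) < H := by exact_mod_cast hH
  have hK : (2 * del (H / 2) + 4 * 100 / ((H / 2 : ℕ) + 1 : ℝ)) * N ≤ 802 * N / H := by
    have hδ : 2 * del (H / 2) = 1 / ((H / 2 : ℕ) + 1 : ℝ) := by unfold del; field_simp
    rw [hδ]
    have : (H : ℝ) ≤ 2 * ((H / 2 : ℕ) + 1 : ℝ) := by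
      have : H ≤ 2 * (H / 2 + 1) := by omega
      exact_mod_cast this
    have hN : (0 : ℝ) ≤ N := Nat.cast_nonneg N
    rw [show (1 / ((H / 2 : ℕ) + 1 : ℝ) + 4 * 100 / ((H / 2 : ℕ) + 1 : ℝ)) = 401 / ((H / 2 : ℕ) + 1 : ℝ) by
      ring, div_mul_eq_mul_div, div_le_div_iff₀ (by positivity) hH0]
    nlinarith
  have hs2' : 2 * s = b - a := by rw [hsdef]; ring
  rw [abs_le]
  constructor
  · nlinarith [hlow, hU', hsplit, hE, hK, hs2']
  · nlinarith [hup, hU, hE, hK, hs2']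

/-- **The Erdős–Turán inequality for closed intervals** `[a, b] ⊆ [0, 1]` (the form matching
CDT's Definition 44 of the box discrepancy). [cite: Travaglini2014, Thm 7.3] -/
theorem erdosTuran_closed (ω : Fin N → ℝ) {a b : ℝ} (ha : 0 ≤ a) (hab : a ≤ b) (hb : b ≤ 1)
    {H : ℕ} (hH : 1 ≤ H) :
    abs ((((Finset.univ : Finset (Fin N)).filter
        (fun n => a ≤ Int.fract (ω n) ∧ Int.fract (ω n) ≤ b)).card : ℝ) - (b - a) * N) ≤
      802 * N / H + (2 / π + 1600) * ∑ d ∈ Finset.Icc 1 H, ‖expSum ω d‖ / d := by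
  set m : ℝ := (a + b) / 2 with hm
  set s : ℝ := (b - a) / 2 with hsdef
  have hs : 0 ≤ s := by rw [hsdef]; linarith
  have hs2 : s ≤ 1 / 2 := by rw [hsdef]; linarith
  have hup : (((Finset.univ : Finset (Fin N)).filter
      (fun n => a ≤ Int.fract (ω n) ∧ Int.fract (ω n) ≤ b)).card : ℝ) ≤
      (((Finset.univ : Finset (Fin N)).filter (fun n => distZ (ω n - m) ≤ s)).card : ℝ) := by
    exact_mod_cast Finset.card_le_card fun n hn => by
      rw [Finset.mem_filter] at hn ⊢
      refine ⟨hn.1, ?_⟩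
      obtain ⟨h1, h2⟩ := hn.2
      refine (distZ_le_abs_sub_int _ ⌊ω n⌋).trans ?_
      rw [show ω n - m - (⌊ω n⌋ : ℤ) = Int.fract (ω n) - m by rw [Int.fract]; ring, abs_le]
      constructor <;> [rw [hm]; rw [hm, hsdef]] <;> linarith
  have hlow : (((Finset.univ : Finset (Fin N)).filter
      (fun n => ¬ (a ≤ Int.fract (ω n) ∧ Int.fract (ω n) ≤ b))).card : ℝ) ≤
      (((Finset.univ : Finset (Fin N)).filter (fun n => distZ (ω n - (m + 1 / 2)) ≤ 1 / 2 - s)).card : ℝ) := by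
    exact_mod_cast Finset.card_le_card fun n hn => by
      rw [Finset.mem_filter] at hn ⊢
      refine ⟨hn.1, ?_⟩
      have hf0 := Int.fract_nonneg (ω n)
      have hf1 := Int.fract_lt_one (ω n)
      rcases not_and_or.mp hn.2 with h | h
      · push Not at h
        refine (distZ_le_abs_sub_int _ (⌊ω n⌋ - 1)).trans ?_
        rw [show ω n - (m + 1 / 2) - ((⌊ω n⌋ - 1 : ℤ) : ℝ) = Int.fract (ω n) - (m - 1 / 2) by
          rw [Int.fract]; push_cast; ring, abs_le]
        constructor <;> [rw [hm, hsdef]; rw [hm, hsdef]] <;> linarith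
      · push Not at h
        refine (distZ_le_abs_sub_int _ ⌊ω n⌋).trans ?_
        rw [show ω n - (m + 1 / 2) - (⌊ω n⌋ : ℤ) = Int.fract (ω n) - (m + 1 / 2) by
          rw [Int.fract]; ring, abs_le]
        constructor <;> [rw [hm, hsdef]; rw [hm, hsdef]] <;> linarith
  have hsplit : (((Finset.univ : Finset (Fin N)).filter
      (fun n => a ≤ Int.fract (ω n) ∧ Int.fract (ω n) ≤ b)).card : ℝ) +
      (((Finset.univ : Finset (Fin N)).filter
        (fun n => ¬ (a ≤ Int.fract (ω n) ∧ Int.fract (ω n) ≤ b))).card : ℝ) = N := by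
    have := Finset.card_filter_add_card_filter_not (s := (Finset.univ : Finset (Fin N)))
      (fun n => a ≤ Int.fract (ω n) ∧ Int.fract (ω n) ≤ b)
    rw [Finset.card_fin] at this
    exact_mod_cast this
  have hU := arcCount_le (M := H / 2) ω m hs
  have hU' := arcCount_le (M := H / 2) ω (m + 1 / 2) (s := 1 / 2 - s) (by linarith)
  have hE := errET_le hH ω
  have hH0 : (0 : ℝ) < H := by exact_mod_cast hH
  have hK : (2 * del (H / 2) + 4 * 100 / ((H / 2 : ℕ) + 1 : ℝ)) * N ≤ 802 * N / H := by
    have hδ : 2 * del (H / 2) = 1 / ((H / 2 : ℕ) + 1 : ℝ) := by unfold del; field_simp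
    rw [hδ]
    have : (H : ℝ) ≤ 2 * ((H / 2 : ℕ) + 1 : ℝ) := by
      have : H ≤ 2 * (H / 2 + 1) := by omega
      exact_mod_cast this
    have hN : (0 : ℝ) ≤ N := Nat.cast_nonneg N
    rw [show (1 / ((H / 2 : ℕ) + 1 : ℝ) + 4 * 100 / ((H / 2 : ℕ) + 1 : ℝ)) = 401 / ((H / 2 : ℕ) + 1 : ℝ) by
      ring, div_mul_eq_mul_div, div_le_div_iff₀ (by positivity) hH0]
    nlinarith
  have hs2' : 2 * s = b - a := by rw [hsdef]; ring
  rw [abs_le]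
  constructor
  · nlinarith [hlow, hU', hsplit, hE, hK, hs2']
  · nlinarith [hup, hU, hE, hK, hs2']


end Classical

section Thm72

variable {M : ℕ}

/-- **`∫₀¹ p⁺ = f̂(0)`** (only the zero frequency survives). [folklore] -/
theorem integral_majorP {A s : ℝ} (hs : 0 ≤ s) :
    ∫ x in (0 : ℝ)..1, majorP M A s x = (fhat M A s 0).re := by
  have hI : ((∫ x in (0 : ℝ)..1, majorP M A s x : ℝ) : ℂ) = fhat M A s 0 := by
    rw [intervalIntegral.integral_ofReal.symm]
    simp_rw [majorP_eq_sum hs]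
    have hint : ∀ q ∈ quadIdx M, IntervalIntegrable (fun x : ℝ => fhat M A s (dq q) * e ((dq q : ℝ) * x))
        volume (0 : ℝ) 1 := fun q _ =>
      (continuous_const.mul (continuous_e_mul _)).intervalIntegrable _ _
    rw [intervalIntegral.integral_const_mul, intervalIntegral.integral_finsetSum hint]
    have h2 : ∀ q ∈ quadIdx M, ∫ x in (0 : ℝ)..1, fhat M A s (dq q) * e ((dq q : ℝ) * x) =
        if dq q = 0 then fhat M A s 0 else 0 := by
      intro q _
      rw [intervalIntegral.integral_const_mul, integral_e_int]
      split_ifs with h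
      · rw [h]; simp
      · simp
    rw [Finset.sum_congr rfl h2, ← Finset.sum_filter, Finset.sum_const, nsmul_eq_mul]
    have h1 := coefC_mul_card_zero (M := M)
    calc (coefC M : ℂ) * ((((quadIdx M).filter (fun q => dq q = 0)).card : ℂ) * fhat M A s 0)
        = ((coefC M * ((quadIdx M).filter (fun q => dq q = 0)).card : ℝ) : ℂ) * fhat M A s 0 := by
          push_cast; ring
      _ = fhat M A s 0 := by rw [h1]; push_cast; ring
  have := congrArg Complex.re hI
  rwa [Complex.ofReal_re] at this

/-- **Travaglini's Theorem 7.2 (majorant half), quantitative**: `p⁺ = majorP M 100 s` is a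
trigonometric polynomial of degree `≤ 2M` (`majorP_eq_sum`) with `p⁺ ≥ 0`, `p⁺ ≥ χ` on the arc
`‖x‖ ≤ s` (`one_le_majorP_of_distZ`, for `s + δ ≤ 1/2`), and
`∫₀¹ p⁺ ≤ 2s + 401/(M+1)`. [cite: Travaglini2014, Thm 7.2, eq. (7.1)] -/
theorem integral_majorP_le {s : ℝ} (hs : 0 ≤ s) :
    ∫ x in (0 : ℝ)..1, majorP M 100 s x ≤ 2 * s + 401 / (M + 1) := by
  rw [integral_majorP hs]
  have h := fhat_zero_re_le (M := M) (A := 100) (by norm_num) hs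
  have hδ : 2 * del M = 1 / (M + 1) := by unfold del; field_simp
  have : 2 * s + 2 * del M + 4 * 100 / ((M : ℝ) + 1) = 2 * s + 401 / (M + 1) := by
    rw [show 2 * s + 2 * del M + 4 * 100 / ((M : ℝ) + 1) = 2 * s + (2 * del M + 4 * 100 / (M + 1)) by ring,
      hδ]; ring
  linarith

end Thm72

end Literature.Analysis.Fourier.TrigApprox
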